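import Literature.Algebra.Homology.DiscreteRepOpenSubgroup
import Literature.Algebra.Homology.DiscreteRepCoinducedShapiro
import Mathlib.LinearAlgebra.StdBasis
import HarnessLib

/-!
# The restriction to an open subgroup of a co-induced module is `Ext(k, –)`-acyclic

Topic `Algebra/Homology`; namespace `Literature.Algebra.Homology.DiscreteRep`.  Sequel of
`DiscreteRepOpenSubgroup` (`resD ⊣ coindD`, `coindD ⊣ resD`, Shapiro in both variables for an open
subgroup `U` of finite index) and `DiscreteRepCoinducedShapiro` (`Extⁿ_{Mod_k}(UA, V) ≃+
Extⁿ_{C_Γ}(A, CoInd_Γ V)`); no named fact, no `sorry`.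

For `Γ` compact, `U ≤ Γ` open of finite index and `V` a `k`-module:

  `Ext^{q+1}_{C_U}(k, Res_U (CoInd_Γ V)) = 0`     (`ext_triv_resD_coind_eq_zero`)

— so the restriction to `U` of the standard complex of `DiscreteRepStandardResolution` is again an
`Ext(k, –)`-ACYCLIC resolution in `C_U`, the input of the compatibility of the comparison
`Extⁿ_{C_Γ}(k, M) ≅ Hⁿ_cont(Γ, M)` with restriction to open subgroups (seat FINDING item (I-a) /
door-c4-g13 §3 (I-a)).  Proof by the two Shapiro lemmas:
`Ext_{C_U}(k, Res A) ≅ Ext_{C_Γ}(Coind_U^Γ k, A)` (`Coind ⊣ Res`) and, for `A = CoInd_Γ V`,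
`Ext_{C_Γ}(B, CoInd_Γ V) ≅ Ext_{Mod_k}(UB, V)` (`forget ⊣ CoInd`), where the underlying module of
`B = Coind_U^Γ k` is `{f : Γ → k | f (u x) = f x} ≅ (U\\Γ → k)`, a finite free — hence projective —
`k`-module.

## References
* D. Harari, *Galois Cohomology and Class Field Theory* (2020), Prop. 1.39, Remark 16.13, §4.3 (2)/(4),
  Remark 4.24. [Harari2020]
* J.-P. Serre, *Galois Cohomology*, Springer (1997), I §2.5. [SerreGaloisCohomology1997]
-/

-- CITATION-FIX (2026-08-27, door-c4 g13; referee flag Q-g51-1 §52.1, held copy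
-- `book:harari2017-galois-cohomology-class-field-theory`): "Prop. 16.17" (cup-product/`Ext` pairing,
-- p. 272) was cited for Shapiro-type steps; corrected to Proposition 1.39 (p. 48, first-variable
-- Shapiro `Ext_H^i(A,B) ≃ Ext_G^i(I_G^H(A),B)`, valid for `H` open by §4.3 (4)) / Remark 16.13 (p. 269,
-- second variable) / Serre I §2.5 (induced modules acyclic).  Declarations unchanged.

noncomputable section

universe u

namespace Literature.Algebra.Homology

namespace DiscreteRep

open CategoryTheory CategoryTheory.Limits CategoryTheory.Abelian

variable {k Γ : Type u} [CommRing k] [Group Γ] [TopologicalSpace Γ] [IsTopologicalGroup Γ]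
  [CompactSpace Γ] (U : Subgroup Γ) (hU : IsOpen (U : Set Γ)) [U.FiniteIndex]

/-- The underlying module of `Coind_U^Γ k` — functions `Γ → k` invariant under left translation by
`U` — is linearly isomorphic to the functions on the (finite) set of right cosets `U\\Γ`.
[cite: Harari2020, Proposition 1.39] -/
def coindTrivLinearEquiv :
    Representation.coindV U.subtype (triv (k := k) (Γ := U) k).obj.ρ ≃ₗ[k]
      (Quotient (QuotientGroup.rightRel U) → k) where
  toFun f q := (f : Γ → k) q.out
  map_add' f g := rfl
  map_smul' c f := rfl
  invFun φ := ⟨fun x => φ (Quotient.mk _ x), fun u x => by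
    change φ (Quotient.mk _ ((u : Γ) * x)) = φ (Quotient.mk _ x)
    congr 1
    apply Quotient.sound
    change (QuotientGroup.rightRel U) ((u : Γ) * x) x
    rw [QuotientGroup.rightRel_apply]
    simp⟩
  left_inv f := by
    apply Subtype.ext
    funext x
    have hx : x * (Quotient.mk (QuotientGroup.rightRel U) x).out⁻¹ ∈ U := by
      have := Quotient.mk_out (s := QuotientGroup.rightRel U) x
      rw [QuotientGroup.rightRel_apply] at this
      exact this
    have hf := (Representation.mem_coindV _ _ _).1 f.2 ⟨_, hx⟩
      (Quotient.mk (QuotientGroup.rightRel U) x).out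
    have h1 : (U.subtype ⟨_, hx⟩ : Γ) * (Quotient.mk (QuotientGroup.rightRel U) x).out = x := by
      simp
    rw [h1] at hf
    exact hf.symm
  right_inv φ := by
    funext q
    change φ (Quotient.mk _ q.out) = φ q
    rw [Quotient.out_eq]

/-- Hence the underlying module of `Coind_U^Γ k` is a free `k`-module (`U` of finite index).
[cite: Harari2020, Proposition 1.39] -/
instance free_coind_triv :
    Module.Free k ((ι k Γ ⋙ forget₂ (Rep.{u} k Γ) (ModuleCat.{u} k)).obj
      ((coindD k U hU).obj (triv (k := k) (Γ := U) k))) := by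
  letI := QuotientGroup.rightRel U
  haveI : Finite (Quotient (QuotientGroup.rightRel U)) :=
    Finite.of_equiv _ (QuotientGroup.quotientRightRelEquivQuotientLeftRel U).symm
  exact Module.Free.of_equiv (coindTrivLinearEquiv (k := k) U).symm

/-- … and therefore projective in `Mod_k`. [cite: Harari2020, Proposition 1.39] -/
instance projective_coind_triv :
    Projective ((ι k Γ ⋙ forget₂ (Rep.{u} k Γ) (ModuleCat.{u} k)).obj
      ((coindD k U hU).obj (triv (k := k) (Γ := U) k))) :=
  ModuleCat.projective_of_categoryTheory_projective _

include hU in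
/-- **`Ext^{q+1}_{C_U}(k, Res_U (CoInd_Γ V)) = 0`**: the restriction to an open subgroup of finite
index of a co-induced module (from the trivial subgroup) is `Ext(k, –)`-acyclic — by the two Shapiro
lemmas and the projectivity of `k^{U\\Γ}`. [cite: Harari2020, Remark 16.13][cite: SerreGaloisCohomology1997, I §2.5] -/
theorem ext_triv_resD_coind_eq_zero (V : ModuleCat.{u} k) (q : ℕ)
    (e : Ext (triv (k := k) (Γ := U) k) ((resD k U).obj ((coindFunctor k Γ).obj V)) (q + 1)) :
    e = 0 := by
  obtain ⟨x, rfl⟩ := (extCoindResAddEquiv U hU (triv (k := k) (Γ := U) k)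
    ((coindFunctor k Γ).obj V) (q + 1)).surjective e
  obtain ⟨y, rfl⟩ := (extCoindAddEquiv ((coindD k U hU).obj (triv (k := k) (Γ := U) k)) V
    (q + 1)).surjective x
  have hy : y = 0 := Ext.eq_zero_of_projective y
  rw [hy, map_zero, map_zero]

include hU in
/-- Object form: `Ext^{q+1}_{C_U}(k, Res_U (coind k Γ V)) = 0`. [cite: SerreGaloisCohomology1997, I §2.5] -/
theorem ext_triv_resD_coind_eq_zero' (V : Type u) [AddCommGroup V] [Module k V] (q : ℕ)
    (e : Ext (triv (k := k) (Γ := U) k) ((resD k U).obj (coind k Γ V)) (q + 1)) : e = 0 :=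
  ext_triv_resD_coind_eq_zero U hU (ModuleCat.of k V) q e

include hU in
/-- Transport: anything in `C_Γ` isomorphic to a co-induced module restricts to an acyclic object.
[cite: SerreGaloisCohomology1997, I §2.5] -/
theorem ext_triv_resD_eq_zero_of_iso_coind {M : DiscreteRepCat k Γ} {V : Type u} [AddCommGroup V]
    [Module k V] (i : M ≅ coind k Γ V) (q : ℕ)
    (x : Ext (triv (k := k) (Γ := U) k) ((resD k U).obj M) (q + 1)) : x = 0 := by
  have h : x.comp (Ext.mk₀ ((resD k U).map i.hom)) (add_zero _) = 0 :=
    ext_triv_resD_coind_eq_zero' U hU V q _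
  have := congrArg (fun y => y.comp (Ext.mk₀ ((resD k U).map i.inv)) (add_zero _)) h
  simpa only [Ext.comp_assoc_of_second_deg_zero, Ext.mk₀_comp_mk₀, ← CategoryTheory.Functor.map_comp,
    Iso.hom_inv_id, CategoryTheory.Functor.map_id, Ext.comp_mk₀_id, Ext.zero_comp] using this

end DiscreteRep

end Literature.Algebra.Homology
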